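import Summits.HodgeConjecture.HodgeConjecture.Theorems.F0LD1ThetaSliceTorusProjector
import Summits.HodgeConjecture.HodgeConjecture.Theorems.F0LD1ThetaSliceBricks
import HarnessLib

-- the brick statement elaborates to a very large type; elaborate sequentially (as in the ★ kit lineage)
set_option Elab.async false

/-!
# (Gβ-P) organ discharge BY NAME: `F0LD1ThetaSliceOfBricks.TorusProjector` holds (line LD1 of crux HLiu418)

Cell hodgecm-mathlib, floor 0; namespace `Summit.HodgeConjecture.HodgeConjecture.Cruxes.HLiu418.F0LD1ThetaSliceTorusProjector`; seat LD1-p02 (g3);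
`--supports stmt-HodgeConjecture-24832 --as helper`.  THEOREMS ONLY.  The brick `TorusProjector` of the (Gβ) junction (★ `F0LD1ThetaSliceBricks`, LD1-p01 (g3)
p850919; junction `F0LD1ThetaSliceOfBricks.thetaSlice₂_of_bricks`) is, unfolded, ★ `F0LD1ThetaSliceTorusProjector.torusProjector` (p850882) — the same
`∀`-body under the same `open`s — so the organ is discharged by that term.  Nothing printed is discharged.  HC_CM is proved only modulo the 7 printed
citations (2 remaining: hLiu418 = stmt-HodgeConjecture-24832, h413 = stmt-HodgeConjecture-24833) until rung 0 closes.
-/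

set_option autoImplicit false
set_option linter.dupNamespace false

namespace Summit.HodgeConjecture.HodgeConjecture.Cruxes.HLiu418.F0LD1ThetaSliceTorusProjector

/-- **(Gβ-P) `TorusProjector` holds** (★ `torusProjector`, p850882: `P_β := Schur.charProjL μT κ_β ((rightRegular μ).restrict k)`).
[cite: BrockerTomDieck1985, III (5.10)] [cite: BorelJacquet1979, §4.6] -/
theorem torusProjector_holds : F0LD1ThetaSliceOfBricks.TorusProjector := by
  intro L
  exact torusProjector L

end Summit.HodgeConjecture.HodgeConjecture.Cruxes.HLiu418.F0LD1ThetaSliceTorusProjector
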